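import Literature.MathematicalPhysics.QuantumLattice.HeatKernelGroupOperatorProofs
import Literature.RepresentationTheory.CompactGroups.TranslationFinite
import HarnessLib

/-!
# Peter–Weyl via the heat kernel: translation-finite functions and joint eigenfunctions (brick 4b)

Fourth brick of the proof of
`Literature.MathematicalPhysics.QuantumLattice.isGroupHeatKernel_unique_up_to_scale` (Hunt 1956,
Thm 5.1 with Schur's lemma), joining the `L²` spectral structure of the heat operators
(`HeatKernelGroupOperatorProofs`) with the algebra `translationFinite G` of translation-finite
(representative) functions (`RepresentationTheory/CompactGroups/TranslationFinite`).

For a compact Hausdorff group `G` with heat kernels `p`, `q` (`IsGroupHeatKernel`):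

* `hp.convCM ht : C(G, ℝ) →L[ℝ] C(G, ℝ)`, `u ↦ p_t ⋆ u`, commutes with left and right
  translations; `𝓔_c = hp.eigC c`, the continuous functions whose `L²` class lies in the
  eigenspace `E_c`, is finite-dimensional (`c ≠ 0`) and translation invariant, so **continuous
  eigenfunctions are translation-finite** (`isTranslationFinite_of_mem_eigC`), with
  `p_t ⋆ u = c^t u` (`convCM_eq_rpow_smul_of_mem_eigC`).
* Conversely **every translation-finite function is a finite sum of joint eigenfunctions**
  (`toL2_mem_iSup_inf_eig`, `exists_sum_eq_of_isTranslationFinite`): the *isotypic envelope*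
  `M(U) = Σ_{A ∈ Hom_G(U, C(G))} A(U)` of the finite-dimensional left-invariant space
  `U = biSpan u` is finite-dimensional — `Hom_G(U, C(G)) ↪ U*` by `A ↦ ev₁ ∘ A`
  (`finiteDimensional_equivariantHom`, Frobenius reciprocity) — contains `U` and is stable under
  every operator commuting with left translations (`map_isotypicEnvelope_le`), in particular under
  `p_1 ⋆` and `q_1 ⋆`; its image in `L²` is a finite-dimensional subspace invariant under the
  commuting symmetric operators `T^p_1`, `T^q_1`, hence spanned by joint eigenvectors
  (`Submodule.le_iSup_inf_eigenspace_of_invariant`).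
* **Density (Peter–Weyl theorem for a compact group carrying a heat kernel)**:
  `translationFinite G` is dense in `C(G, ℝ)` (`dense_translationFinite`): `p_{2⁻ⁿ} ⋆ v → v`
  uniformly, and `p_s ⋆ v = S_s(toL2 v)` is a uniform limit of the translation-finite functions
  `S_s w`, `w` a finite sum of eigenvectors (`L²`-density of eigenvectors, continuity of
  `S_s : L² → C(G)`). Hence `translationFinite G` separates points
  (`separatesPoints_translationFinite`).

Sources: E. M. Stein, *Topics in Harmonic Analysis* (1970), Ch. II §2; T. Bröcker, T. tom Dieck,
*Representations of Compact Lie Groups* (1985), III §1, (3.1), (5.7). No named facts; definitions: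
`toL2` (abbreviation of Mathlib's `ContinuousMap.toLp`), `IsGroupHeatKernel.convCM`,
`IsGroupHeatKernel.eigC`, `equivariantHom`, `isotypicEnvelope`.
-/

open MeasureTheory Filter Topology
open Literature.MathematicalPhysics.QuantumFieldTheory (haarProbability)

noncomputable section


namespace Literature.MathematicalPhysics.QuantumLattice

open Literature.RepresentationTheory.CompactGroups

variable {G : Type*} [Group G] [TopologicalSpace G] [IsTopologicalGroup G] [CompactSpace G]
  [MeasurableSpace G] [BorelSpace G]

variable (G) in
/-- The embedding `C(G, ℝ) → L²(G)` (Mathlib's `ContinuousMap.toLp` for the Haar probability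
measure), abbreviated. [folklore] -/
abbrev toL2 : C(G, ℝ) →L[ℝ] Lp ℝ 2 (haarProbability G) := ContinuousMap.toLp 2 (haarProbability G) ℝ

/-- `toL2` is injective (Haar measure charges open sets). [folklore] -/
theorem toL2_injective : Function.Injective (toL2 G) :=
  ContinuousMap.toLp_injective (haarProbability G)

/-- **Eigenvector decomposition in an invariant finite-dimensional subspace.** For a symmetric
operator `T` on a real inner product space and a finite-dimensional `T`-invariant subspace `W`,
every element of `W` is a (finite) sum of eigenvectors of `T` lying in `W`:
`W ≤ ⨆_c (W ⊓ E_c(T))` (finite-dimensional spectral theorem for `T|_W`). [folklore] -/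
theorem _root_.Submodule.le_iSup_inf_eigenspace_of_invariant {E : Type*} [NormedAddCommGroup E]
    [InnerProductSpace ℝ E] {T : E →ₗ[ℝ] E} (hT : T.IsSymmetric) (W : Submodule ℝ E)
    [FiniteDimensional ℝ W] (hW : ∀ w ∈ W, T w ∈ W) :
    W ≤ ⨆ c, (W ⊓ Module.End.eigenspace T c) := by
  intro f hf
  set Q := T.restrict hW with hQ
  have hQs : Q.IsSymmetric := hT.restrict_invariant hW
  have htop : (⨆ d, Module.End.eigenspace Q d) = ⊤ :=
    Submodule.orthogonal_eq_bot_iff.mp hQs.orthogonalComplement_iSup_eigenspaces_eq_bot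
  have hmem : (⟨f, hf⟩ : W) ∈ ⨆ d, Module.End.eigenspace Q d := by
    rw [htop]; exact Submodule.mem_top
  have hmap := Submodule.mem_map_of_mem (f := W.subtype) hmem
  rw [Submodule.map_iSup] at hmap
  have hle : (⨆ d, Submodule.map W.subtype (Module.End.eigenspace Q d)) ≤
      ⨆ d, (W ⊓ Module.End.eigenspace T d) := by
    refine iSup_mono fun d => ?_
    rintro _ ⟨v, hv, rfl⟩
    refine ⟨v.2, ?_⟩
    have hv' : Q v = d • v := Module.End.mem_eigenspace_iff.mp hv
    have hv'' := congrArg Subtype.val hv'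
    simp only [hQ, LinearMap.coe_restrict_apply, Submodule.coe_smul] at hv''
    exact Module.End.mem_eigenspace_iff.mpr hv''
  exact hle hmap

namespace IsGroupHeatKernel

open scoped InnerProductSpace

variable {p : ℝ → G → ℝ}

/-! ### The heat operators on continuous functions and their equivariance -/

/-- The heat operator on continuous functions, `u ↦ p_t ⋆ u : C(G, ℝ) →L[ℝ] C(G, ℝ)`. [folklore] -/
def convCM (hp : IsGroupHeatKernel p) {t : ℝ} (ht : 0 < t) : C(G, ℝ) →L[ℝ] C(G, ℝ) :=
  (convToCM (hp.continuous ht)).comp (toL2 G)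

/-- `(convCM u)(x) = (p_t ⋆ u)(x)`. [folklore] -/
@[simp]
theorem convCM_apply (hp : IsGroupHeatKernel p) {t : ℝ} (ht : 0 < t) (u : C(G, ℝ)) (x : G) :
    hp.convCM ht u x = haarConv (p t) u x :=
  convToCM_toLp (hp.continuous ht) u x

/-- `toL2 (p_t ⋆ u) = T_t (toL2 u)` (definitional). [folklore] -/
theorem toL2_convCM (hp : IsGroupHeatKernel p) {t : ℝ} (ht : 0 < t) (u : C(G, ℝ)) :
    toL2 G (hp.convCM ht u) = hp.opL2 ht (toL2 G u) := rfl

/-- `p_t ⋆` commutes with left translations on `C(G, ℝ)` (centrality). [folklore] -/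
theorem convCM_lTrans (hp : IsGroupHeatKernel p) {t : ℝ} (ht : 0 < t) (g : G) (u : C(G, ℝ)) :
    hp.convCM ht (lTrans g u) = lTrans g (hp.convCM ht u) := by
  ext x
  simp only [convCM_apply, lTrans_apply]
  exact hp.haarConv_comp_mul_left ht u g x

/-- `p_t ⋆` commutes with right translations on `C(G, ℝ)`. [folklore] -/
theorem convCM_rTrans (hp : IsGroupHeatKernel p) {t : ℝ} (ht : 0 < t) (g : G) (u : C(G, ℝ)) :
    hp.convCM ht (rTrans g u) = rTrans g (hp.convCM ht u) := by
  ext x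
  simp only [convCM_apply, rTrans_apply]
  exact haarConv_comp_mul_right (p t) u g x

/-! ### Continuous eigenfunctions are translation-finite -/

/-- The space `𝓔_c` of continuous functions whose `L²` class lies in the eigenspace `E_c`. [folklore] -/
abbrev eigC (hp : IsGroupHeatKernel p) (c : ℝ) : Submodule ℝ C(G, ℝ) :=
  (hp.eig c).comap ((toL2 G : C(G, ℝ) →L[ℝ] Lp ℝ 2 (haarProbability G)) :
    C(G, ℝ) →ₗ[ℝ] Lp ℝ 2 (haarProbability G))

/-- Membership in `𝓔_c`. [folklore] -/
theorem mem_eigC_iff (hp : IsGroupHeatKernel p) {c : ℝ} {u : C(G, ℝ)} :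
    u ∈ hp.eigC c ↔ toL2 G u ∈ hp.eig c := Iff.rfl

/-- On `𝓔_c` the heat operator acts by `p_1 ⋆ u = c u` as continuous functions. [folklore] -/
theorem convCM_eq_smul_of_mem_eigC (hp : IsGroupHeatKernel p) {c : ℝ} {u : C(G, ℝ)}
    (hu : u ∈ hp.eigC c) : hp.convCM one_pos u = c • u := by
  apply toL2_injective
  rw [toL2_convCM, map_smul]
  exact hp.mem_eig_iff.mp hu

/-- On `𝓔_c`, `c > 0`, `p_t ⋆ u = c^t u` for all `t > 0`. [folklore] -/
theorem convCM_eq_rpow_smul_of_mem_eigC [T2Space G] (hp : IsGroupHeatKernel p) {c : ℝ}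
    (hc : 0 < c) {u : C(G, ℝ)} (hu : u ∈ hp.eigC c) {t : ℝ} (ht : 0 < t) :
    hp.convCM ht u = (c ^ t) • u := by
  apply toL2_injective
  rw [toL2_convCM, map_smul]
  exact hp.opL2_eq_smul_of_mem_eig hc ht hu

/-- `𝓔_c` is stable under left translations. [folklore] -/
theorem lTrans_mem_eigC (hp : IsGroupHeatKernel p) {c : ℝ} {u : C(G, ℝ)} (hu : u ∈ hp.eigC c)
    (g : G) : lTrans g u ∈ hp.eigC c := by
  rw [mem_eigC_iff, mem_eig_iff, ← toL2_convCM, convCM_lTrans, hp.convCM_eq_smul_of_mem_eigC hu,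
    map_smul, map_smul]

/-- `𝓔_c` is stable under right translations. [folklore] -/
theorem rTrans_mem_eigC (hp : IsGroupHeatKernel p) {c : ℝ} {u : C(G, ℝ)} (hu : u ∈ hp.eigC c)
    (g : G) : rTrans g u ∈ hp.eigC c := by
  rw [mem_eigC_iff, mem_eig_iff, ← toL2_convCM, convCM_rTrans, hp.convCM_eq_smul_of_mem_eigC hu,
    map_smul, map_smul]

/-- `biSpan u ≤ 𝓔_c` for `u ∈ 𝓔_c`. [folklore] -/
theorem biSpan_le_eigC (hp : IsGroupHeatKernel p) {c : ℝ} {u : C(G, ℝ)} (hu : u ∈ hp.eigC c) :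
    biSpan u ≤ hp.eigC c := by
  refine Submodule.span_le.mpr ?_
  rintro _ ⟨⟨g, h⟩, rfl⟩
  exact hp.lTrans_mem_eigC (hp.rTrans_mem_eigC hu h) g

/-- `𝓔_c` is finite-dimensional for `c ≠ 0` (`toL2` is injective and `E_c` is). [folklore] -/
instance finiteDimensional_eigC (hp : IsGroupHeatKernel p) (c : ℝ) [NeZero c] :
    FiniteDimensional ℝ (hp.eigC c) := by
  let φ : hp.eigC c →ₗ[ℝ] hp.eig c :=
    ((toL2 G : C(G, ℝ) →L[ℝ] Lp ℝ 2 (haarProbability G)) :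
      C(G, ℝ) →ₗ[ℝ] Lp ℝ 2 (haarProbability G)).restrict fun u hu => hu
  have hφ : Function.Injective φ := by
    intro u v h
    apply Subtype.ext
    apply toL2_injective
    simpa [φ] using congrArg Subtype.val h
  exact Module.Finite.of_injective φ hφ

/-- **Continuous eigenfunctions of the heat operator are translation-finite** (`c ≠ 0`). [folklore] -/
theorem isTranslationFinite_of_mem_eigC (hp : IsGroupHeatKernel p) {c : ℝ} (hc : c ≠ 0)
    {u : C(G, ℝ)} (hu : u ∈ hp.eigC c) : IsTranslationFinite u :=
  haveI : NeZero c := ⟨hc⟩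
  IsTranslationFinite.of_le (hp.biSpan_le_eigC hu)

/-! ### Translation-finite functions are finite sums of joint eigenfunctions -/

section Isotypic

variable (U : Submodule ℝ C(G, ℝ)) (hU : ∀ g, ∀ v ∈ U, lTrans g v ∈ U)

omit [CompactSpace G] [MeasurableSpace G] [BorelSpace G] in
/-- The space of left-equivariant linear maps `U → C(G, ℝ)` from a left-invariant subspace `U`
(the "isotypic" maps of `U` into `C(G)`). [folklore] -/
def equivariantHom : Submodule ℝ (U →ₗ[ℝ] C(G, ℝ)) where
  carrier := {A | ∀ (g : G) (v : C(G, ℝ)) (hv : v ∈ U), A ⟨lTrans g v, hU g v hv⟩ = lTrans g (A ⟨v, hv⟩)}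
  add_mem' {A B} hA hB g v hv := by
    simp only [LinearMap.add_apply, map_add, hA g v hv, hB g v hv]
  zero_mem' g v hv := by simp
  smul_mem' c A hA g v hv := by
    simp only [LinearMap.smul_apply, map_smul, hA g v hv]

omit [CompactSpace G] [MeasurableSpace G] [BorelSpace G] in
/-- **Equivariant maps `U → C(G)` are determined by their value at `1`**: `A ↦ ev₁ ∘ A` is
injective on `equivariantHom U`, since `(A v)(g) = (A (v(g ·)))(1)`. Hence
`dim Hom_G(U, C(G)) ≤ dim U` (Frobenius reciprocity; Bröcker–tom Dieck III (1.5)). [folklore] -/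
theorem finiteDimensional_equivariantHom [FiniteDimensional ℝ U] :
    FiniteDimensional ℝ (equivariantHom U hU) := by
  let ev1 : C(G, ℝ) →ₗ[ℝ] ℝ :=
    { toFun := fun f => f 1, map_add' := fun _ _ => rfl, map_smul' := fun _ _ => rfl }
  let Φ : equivariantHom U hU →ₗ[ℝ] (U →ₗ[ℝ] ℝ) :=
    { toFun := fun A => ev1.comp A.1
      map_add' := fun _ _ => rfl
      map_smul' := fun _ _ => rfl }
  have key : ∀ A : equivariantHom U hU, Φ A = 0 → A = 0 := by
    intro A hA
    apply Subtype.ext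
    ext ⟨v, hv⟩ x
    have h1 : (A.1 ⟨v, hv⟩) x = (lTrans x (A.1 ⟨v, hv⟩)) 1 := by simp
    rw [h1, ← A.2 x v hv]
    have := LinearMap.congr_fun hA ⟨lTrans x v, hU x v hv⟩
    simpa [Φ, ev1] using this
  have hΦ : Function.Injective Φ := by
    intro A B hAB
    have h0 : Φ (A - B) = 0 := by
      change ev1.comp (A - B).1 = 0
      rw [Submodule.coe_sub, LinearMap.comp_sub]
      change Φ A - Φ B = 0
      rw [hAB, sub_self]
    exact sub_eq_zero.mp (key (A - B) h0)
  exact Module.Finite.of_injective Φ hΦ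

omit [CompactSpace G] [MeasurableSpace G] [BorelSpace G] in
/-- The **isotypic envelope** `M(U) = Σ_{A ∈ Hom_G(U, C(G))} A(U)`: a finite-dimensional subspace
of `C(G, ℝ)` containing `U` and stable under every linear operator of `C(G, ℝ)` commuting with
left translations. [folklore] -/
abbrev isotypicEnvelope : Submodule ℝ C(G, ℝ) :=
  Submodule.map₂ (LinearMap.id : (U →ₗ[ℝ] C(G, ℝ)) →ₗ[ℝ] (U →ₗ[ℝ] C(G, ℝ)))
    (equivariantHom U hU) ⊤

omit [CompactSpace G] [MeasurableSpace G] [BorelSpace G] in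
/-- `U ⊆ M(U)` (the inclusion is equivariant). [folklore] -/
theorem le_isotypicEnvelope : U ≤ isotypicEnvelope U hU := by
  intro u hu
  have hsub : U.subtype ∈ equivariantHom U hU := fun g v hv => rfl
  have := Submodule.apply_mem_map₂ (LinearMap.id : (U →ₗ[ℝ] C(G, ℝ)) →ₗ[ℝ] (U →ₗ[ℝ] C(G, ℝ)))
    hsub (Submodule.mem_top (x := (⟨u, hu⟩ : U)))
  simpa using this

omit [CompactSpace G] [MeasurableSpace G] [BorelSpace G] in
/-- `M(U)` is finite-dimensional for finite-dimensional `U`. [folklore] -/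
instance finiteDimensional_isotypicEnvelope [FiniteDimensional ℝ U] :
    FiniteDimensional ℝ (isotypicEnvelope U hU) := by
  haveI := finiteDimensional_equivariantHom U hU
  have h : (isotypicEnvelope U hU).FG :=
    Submodule.FG.map₂ _ (Submodule.fg_iff_finiteDimensional _ |>.mpr inferInstance)
      (Submodule.fg_iff_finiteDimensional _ |>.mpr inferInstance)
  exact (Submodule.fg_iff_finiteDimensional _).mp h

omit [CompactSpace G] [MeasurableSpace G] [BorelSpace G] in
/-- An operator commuting with left translations maps the isotypic envelope into itself. [folklore] -/
theorem map_isotypicEnvelope_le (S : C(G, ℝ) →ₗ[ℝ] C(G, ℝ))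
    (hS : ∀ (g : G) (v : C(G, ℝ)), S (lTrans g v) = lTrans g (S v)) :
    ∀ w ∈ isotypicEnvelope U hU, S w ∈ isotypicEnvelope U hU := by
  intro w hw
  have hle : isotypicEnvelope U hU ≤ (isotypicEnvelope U hU).comap S := by
    refine Submodule.map₂_le.mpr fun A hA v _ => ?_
    have hSA : S.comp A ∈ equivariantHom U hU := fun g v' hv' => by
      simp only [LinearMap.comp_apply, hA g v' hv', hS]
    simpa using Submodule.apply_mem_map₂
      (LinearMap.id : (U →ₗ[ℝ] C(G, ℝ)) →ₗ[ℝ] (U →ₗ[ℝ] C(G, ℝ))) hSA (Submodule.mem_top (x := v))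
  exact hle hw

end Isotypic

/-- **Translation-finite functions are finite sums of joint eigenfunctions.** For heat kernels
`p`, `q` of `G` and a translation-finite `u`, the `L²` class of `u` lies in
`⨆_{c,d} (E^p_c ⊓ E^q_d)`: the isotypic envelope `M` of `biSpan u` is finite-dimensional and
stable under `p_1 ⋆` and `q_1 ⋆` (which commute with left translations), so `toL2 M` is a
finite-dimensional subspace of `L²` invariant under the commuting symmetric operators
`T^p_1`, `T^q_1` and decomposes into joint eigenvectors. [folklore] -/
theorem toL2_mem_iSup_inf_eig [T2Space G] {q : ℝ → G → ℝ} (hp : IsGroupHeatKernel p)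
    (hq : IsGroupHeatKernel q) {u : C(G, ℝ)} (hu : IsTranslationFinite u) :
    toL2 G u ∈ ⨆ c, ⨆ d, (hp.eig c ⊓ hq.eig d) := by
  haveI := hu.finiteDimensional
  set U := biSpan u
  have hU : ∀ g, ∀ v ∈ U, lTrans g v ∈ U := fun g v hv => lTrans_mem_biSpan g hv
  set M := isotypicEnvelope U hU with hM
  -- `M' = toL2 M`, finite-dimensional and invariant under both time-one operators
  set M' : Submodule ℝ (Lp ℝ 2 (haarProbability G)) :=
    M.map ((toL2 G : C(G, ℝ) →L[ℝ] Lp ℝ 2 (haarProbability G)) :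
      C(G, ℝ) →ₗ[ℝ] Lp ℝ 2 (haarProbability G)) with hM'
  haveI : FiniteDimensional ℝ M' := Module.Finite.map _ _
  have hinvp : ∀ w ∈ M', (hp.opL2 one_pos : Lp ℝ 2 (haarProbability G) →ₗ[ℝ]
      Lp ℝ 2 (haarProbability G)) w ∈ M' := by
    rintro _ ⟨v, hv, rfl⟩
    refine ⟨hp.convCM one_pos v, ?_, rfl⟩
    exact map_isotypicEnvelope_le U hU (hp.convCM one_pos : C(G, ℝ) →ₗ[ℝ] C(G, ℝ))
      (fun g v => hp.convCM_lTrans one_pos g v) v hv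
  have hinvq : ∀ w ∈ M', (hq.opL2 one_pos : Lp ℝ 2 (haarProbability G) →ₗ[ℝ]
      Lp ℝ 2 (haarProbability G)) w ∈ M' := by
    rintro _ ⟨v, hv, rfl⟩
    refine ⟨hq.convCM one_pos v, ?_, rfl⟩
    exact map_isotypicEnvelope_le U hU (hq.convCM one_pos : C(G, ℝ) →ₗ[ℝ] C(G, ℝ))
      (fun g v => hq.convCM_lTrans one_pos g v) v hv
  -- decompose under `T^p_1`, then each piece under `T^q_1`
  have h1 : M' ≤ ⨆ c, (M' ⊓ hp.eig c) :=
    Submodule.le_iSup_inf_eigenspace_of_invariant (hp.opL2_isSymmetric one_pos) M' hinvp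
  have h2 : ∀ c, M' ⊓ hp.eig c ≤ ⨆ d, (hp.eig c ⊓ hq.eig d) := by
    intro c
    haveI : FiniteDimensional ℝ (M' ⊓ hp.eig c : Submodule ℝ _) :=
      Submodule.finiteDimensional_inf_left _ _
    have hinv' : ∀ w ∈ M' ⊓ hp.eig c, (hq.opL2 one_pos : Lp ℝ 2 (haarProbability G) →ₗ[ℝ]
        Lp ℝ 2 (haarProbability G)) w ∈ M' ⊓ hp.eig c :=
      fun w hw => ⟨hinvq w hw.1, hp.opL2_mem_eig hq one_pos hw.2⟩
    refine (Submodule.le_iSup_inf_eigenspace_of_invariant (hq.opL2_isSymmetric one_pos) _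
      hinv').trans (iSup_mono fun d => ?_)
    exact fun w hw => ⟨hw.1.2, hw.2⟩
  have hle : M' ≤ ⨆ c, ⨆ d, (hp.eig c ⊓ hq.eig d) :=
    h1.trans (iSup_mono fun c => h2 c)
  exact hle ⟨u, le_isotypicEnvelope U hU (self_mem_biSpan u), rfl⟩

/-- Every element of an eigenspace `E_c` of the heat operator has a continuous representative
(for `c ≠ 0` by `exists_toLp_eq_of_eigen`; for `c = 0` it vanishes). [folklore] -/
theorem exists_toL2_eq_of_mem_eig [T2Space G] (hp : IsGroupHeatKernel p) {c : ℝ}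
    {f : Lp ℝ 2 (haarProbability G)} (hf : f ∈ hp.eig c) : ∃ v : C(G, ℝ), toL2 G v = f := by
  by_cases hc : c = 0
  · subst hc
    rw [hp.eig_zero, Submodule.mem_bot] at hf
    exact ⟨0, by rw [hf, map_zero]⟩
  · obtain ⟨v, hv, -⟩ := hp.exists_toLp_eq_of_eigen one_pos hc (hp.mem_eig_iff.mp hf)
    exact ⟨v, hv⟩

/-- **Decomposition of a translation-finite function into joint eigenfunctions**: for heat
kernels `p`, `q` of `G` and translation-finite `u` there are finitely many continuous `v_{c,d}`
with `toL2 v_{c,d} ∈ E^p_c ⊓ E^q_d` and `u = Σ v_{c,d}`. [folklore] -/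
theorem exists_sum_eq_of_isTranslationFinite [T2Space G] {q : ℝ → G → ℝ}
    (hp : IsGroupHeatKernel p) (hq : IsGroupHeatKernel q) {u : C(G, ℝ)}
    (hu : IsTranslationFinite u) :
    ∃ (s : Finset (ℝ × ℝ)) (v : ℝ × ℝ → C(G, ℝ)),
      (∀ cd, toL2 G (v cd) ∈ hp.eig cd.1 ⊓ hq.eig cd.2) ∧ u = ∑ cd ∈ s, v cd := by
  have h := hp.toL2_mem_iSup_inf_eig hq hu
  have h' : toL2 G u ∈ ⨆ cd : ℝ × ℝ, (hp.eig cd.1 ⊓ hq.eig cd.2) := by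
    rw [iSup_prod]; exact h
  obtain ⟨f, hf, hsum⟩ := (Submodule.mem_iSup_iff_exists_finsupp _ _).mp h'
  choose v hv using fun cd => hp.exists_toL2_eq_of_mem_eig (hf cd).1
  refine ⟨f.support, v, fun cd => by rw [hv]; exact hf cd, ?_⟩
  apply toL2_injective
  rw [map_sum]
  simp only [hv]
  rw [← hsum, Finsupp.sum]

/-- Conversely, a continuous function whose `L²` class is a finite sum of joint eigenvectors is
translation-finite. [folklore] -/
theorem isTranslationFinite_of_toL2_mem [T2Space G] {q : ℝ → G → ℝ} (hp : IsGroupHeatKernel p)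
    (hq : IsGroupHeatKernel q) {u : C(G, ℝ)} (hu : toL2 G u ∈ ⨆ c, ⨆ d, (hp.eig c ⊓ hq.eig d)) :
    IsTranslationFinite u := by
  have h' : toL2 G u ∈ ⨆ cd : ℝ × ℝ, (hp.eig cd.1 ⊓ hq.eig cd.2) := by
    rw [iSup_prod]; exact hu
  obtain ⟨f, hf, hsum⟩ := (Submodule.mem_iSup_iff_exists_finsupp _ _).mp h'
  choose v hv using fun cd => hp.exists_toL2_eq_of_mem_eig (hf cd).1
  have hu_eq : u = ∑ cd ∈ f.support, v cd := by
    apply toL2_injective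
    rw [map_sum]
    simp only [hv]
    rw [← hsum, Finsupp.sum]
  have hmem : ∀ cd, v cd ∈ translationFinite G := by
    intro cd
    by_cases hc : cd.1 = 0
    · have h0 : f cd = 0 := by
        have h1 : f cd ∈ hp.eig cd.1 := (hf cd).1
        rw [hc, hp.eig_zero] at h1
        simpa using h1
      have : v cd = 0 := toL2_injective (by rw [hv, h0, map_zero])
      rw [this]
      exact (translationFinite G).zero_mem
    · exact hp.isTranslationFinite_of_mem_eigC hc (by rw [mem_eigC_iff, hv]; exact (hf cd).1)
  rw [show IsTranslationFinite u ↔ u ∈ translationFinite G from Iff.rfl, hu_eq]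
  exact Subalgebra.sum_mem _ fun cd _ => hmem cd

/-! ### Density of translation-finite functions (Peter–Weyl via the heat kernel) -/

/-- The smoothing operator `S_s = convToCM` maps the span of the eigenvectors of `T_1` into the
translation-finite functions: on `E_c`, `S_s f = c^s v` for the continuous representative `v`
of `f`. [folklore] -/
theorem convToCM_mem_translationFinite [T2Space G] (hp : IsGroupHeatKernel p) {s : ℝ}
    (hs : 0 < s) {w : Lp ℝ 2 (haarProbability G)} (hw : w ∈ ⨆ c, hp.eig c) :
    convToCM (hp.continuous hs) w ∈ translationFinite G := by
  obtain ⟨f, hf, hsum⟩ := (Submodule.mem_iSup_iff_exists_finsupp _ _).mp hw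
  rw [← hsum, Finsupp.sum, map_sum]
  refine Subalgebra.sum_mem _ fun c _ => ?_
  by_cases h0 : f c = 0
  · rw [h0, map_zero]; exact (translationFinite G).zero_mem
  · have hc : 0 < c := hp.eigenvalue_pos (hf c) h0
    obtain ⟨v, hv⟩ := hp.exists_toL2_eq_of_mem_eig (hf c)
    have hvE : v ∈ hp.eigC c := by rw [mem_eigC_iff, hv]; exact hf c
    have : convToCM (hp.continuous hs) (f c) = (c ^ s) • v := by
      rw [← hv]
      exact hp.convCM_eq_rpow_smul_of_mem_eigC hc hvE hs
    rw [this]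
    exact (translationFinite G).smul_mem (hp.isTranslationFinite_of_mem_eigC hc.ne' hvE) _

/-- For every continuous `v` and `s > 0`, the smoothed function `p_s ⋆ v` lies in the uniform
closure of the translation-finite functions (`toL2 v` is an `L²`-limit of finite sums of
eigenvectors, and `S_s : L² → C(G)` is continuous). [folklore] -/
theorem convCM_mem_closure_translationFinite [T2Space G] (hp : IsGroupHeatKernel p) {s : ℝ}
    (hs : 0 < s) (v : C(G, ℝ)) :
    hp.convCM hs v ∈ closure (translationFinite G : Set C(G, ℝ)) := by
  have hdense : toL2 G v ∈ ((⨆ c, hp.eig c).topologicalClosure : Set (Lp ℝ 2 (haarProbability G))) := by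
    rw [hp.iSup_eig_dense]; trivial
  rw [Submodule.topologicalClosure_coe] at hdense
  have himage := image_closure_subset_closure_image (convToCM (hp.continuous hs)).continuous
    ⟨toL2 G v, hdense, rfl⟩
  refine closure_mono ?_ himage
  rintro _ ⟨w, hw, rfl⟩
  exact hp.convToCM_mem_translationFinite hs hw

/-- **Density of the translation-finite functions** (Peter–Weyl theorem for a compact group
carrying a heat kernel): `translationFinite G` is dense in `C(G, ℝ)` for the uniform norm, since
`p_{2⁻ⁿ} ⋆ v → v` uniformly and each `p_s ⋆ v` is a uniform limit of translation-finite
functions (Stein 1970 Ch. II §2; Bröcker–tom Dieck III (3.1)). [folklore] -/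
theorem dense_translationFinite [T2Space G] (hp : IsGroupHeatKernel p) :
    Dense (translationFinite G : Set C(G, ℝ)) := by
  refine dense_iff_closure_eq.mpr (Set.eq_univ_of_forall fun v => ?_)
  have hs : ∀ n : ℕ, (0 : ℝ) < 1 / 2 ^ n := fun n => by positivity
  have hs0 : Tendsto (fun n : ℕ => (1 : ℝ) / 2 ^ n) atTop (𝓝 0) := by
    simpa [div_eq_mul_inv] using tendsto_pow_atTop_nhds_zero_of_lt_one (r := (2 : ℝ)⁻¹)
      (by positivity) (by norm_num)
  have hlim : Tendsto (fun n => hp.convCM (hs n) v) atTop (𝓝 v) := by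
    rw [ContinuousMap.tendsto_iff_tendstoUniformly, Metric.tendstoUniformly_iff]
    intro ε hε
    have hs' : Tendsto (fun n : ℕ => (1 : ℝ) / 2 ^ n) atTop (𝓝[>] 0) :=
      tendsto_nhdsWithin_of_tendsto_nhds_of_eventually_within _ hs0 (Eventually.of_forall hs)
    filter_upwards [hs'.eventually (hp.eventually_forall_abs_haarConv_sub_lt v hε)] with n hn x
    rw [Real.dist_eq, abs_sub_comm, convCM_apply]
    exact hn x
  exact isClosed_closure.mem_of_tendsto hlim
    (Eventually.of_forall fun n => hp.convCM_mem_closure_translationFinite (hs n) v)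

/-- The uniform closure of the subalgebra of translation-finite functions is everything. [folklore] -/
theorem topologicalClosure_translationFinite [T2Space G] (hp : IsGroupHeatKernel p) :
    (translationFinite G).topologicalClosure = ⊤ := by
  apply SetLike.coe_injective
  rw [Subalgebra.topologicalClosure_coe, (hp.dense_translationFinite).closure_eq]
  rfl

/-- **Translation-finite functions separate the points** of a compact Hausdorff group carrying a
heat kernel (density and Urysohn). [folklore] -/
theorem separatesPoints_translationFinite [T2Space G] (hp : IsGroupHeatKernel p) :
    (translationFinite G).SeparatesPoints := by
  intro x y hxy
  by_contra hcon
  push Not at hcon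
  -- every translation-finite function, hence every continuous function, agrees at `x` and `y`
  have hall : ∀ f ∈ (translationFinite G : Set C(G, ℝ)), f x = f y :=
    fun f hf => hcon (f : G → ℝ) ⟨f, hf, rfl⟩
  have hclosed : IsClosed {f : C(G, ℝ) | f x = f y} :=
    isClosed_eq (continuous_eval_const x) (continuous_eval_const y)
  have hsub : closure (translationFinite G : Set C(G, ℝ)) ⊆ {f : C(G, ℝ) | f x = f y} :=
    closure_minimal hall hclosed
  rw [(hp.dense_translationFinite).closure_eq] at hsub
  obtain ⟨u, hu⟩ := exists_continuous_apply_ne (X := G) hxy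
  exact hu (hsub (Set.mem_univ u))

end IsGroupHeatKernel

end Literature.MathematicalPhysics.QuantumLattice
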